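import Literature.AlgebraicGeometry.Frobenioids.PadicFrobenioidRmk121
import Literature.AlgebraicGeometry.Frobenioids.PadicFrobenioidPreModel
import Literature.AlgebraicGeometry.Frobenioids.PadicUnitGroupProfinite
import Literature.AlgebraicGeometry.Frobenioids.UnitLinearFrobenius
import Literature.AlgebraicGeometry.Frobenioids.UnitWiseFrobeniusHolds
import Literature.AlgebraicGeometry.Frobenioids.UnitWiseFrobeniusZetaExists
import HarnessLib

/-!
# Frobenioids II, Remark 1.2.1 — UNCONDITIONAL at the bound vocabulary (proof-only)

Mochizuki, *The geometry of Frobenioids II: poly-Frobenioids*, Kyushu J. Math. **62** (2008) 401–460,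
§1, Remark 1.2.1 (Kyushu p. 408 = kurims p. 10): "We observe in passing that if `Φ` is absolutely
primitive, then by Theorem 1.2(i) and (v), it follows that `C` admits unit-linear Frobenius functors as in
[Mzk5, Proposition 2.5(iii)] (where one takes the '`Λ`' of loc. cit. to be `ℤ`), and unit-wise Frobenius
functors as in [Mzk5, Corollary 2.6]. If, moreover, `Λ = ℤ`, then `C` admits unit-wise Frobenius functors
as in [Mzk5, Proposition 2.9(ii)]." [cite: MochizukiFrdII2008, Rmk 1.2.1 p.10]

PROOF-ONLY companion (abc-iut cell, layer L1, seat abc-iut-w5-d214 — the W11 holder of [FrdII] Thm. 1.2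
(i) s.2 + (v), on which the Remark rests "by Theorem 1.2(i) and (v)"; node `FrdII:Rmk1.2.1`, statement
`PadicFrd.Rmk121 d V` of `PadicFrobenioidThm12.lean`, seat abc-iut-L1-t4; slot binding
`Thm12Vocab.bindFrobenius` and the CONDITIONAL derivation `PadicFrd.Datum.rmk121_bindFrobenius`, seat
abc-iut-L1-t4 gen 2, `PadicFrobenioidRmk121.lean`). CENSUS: every one of the seven hypotheses of
`rmk121_bindFrobenius` is now a theorem of the tree —
* `hF` "`C → F_Φ` is a Frobenioid": `isFrobenioid_of_isMonoidData` (abc-iut-L1-d8; premise = print's standing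
  requirement "`Φ`, `B` monoids on `D`", [FrdII] Ex. 1.1 (ii), automatic over FSM-type bases);
* `h25` [FrdI] Prop. 2.5 (iii): `PreFrobenioid.unitLinearFrobeniusExists` (abc-iut-L6-t9 lineage, p411338);
* `h26` [FrdI] Cor. 2.6: `PreFrobenioid.unitWiseFrobeniusExists` (`UnitWiseFrobeniusHolds.lean`, p414661);
* `h29` [FrdI] Prop. 2.9 (ii): `PreFrobenioid.unitWiseFrobeniusZetaExists` (`UnitWiseFrobeniusZetaExists.lean`);
* `hiso` Thm. 1.2 (i) "isotropic": `thm12_isOfIsotropicType` (abc-iut-L1-d10 gen 2, p408580);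
* `hpre` [FrdI] Def. 2.7 (iii) "pre-model", any base: `thm12_isOfPreModelType'` (abc-iut-w4-d108, p413486);
* `hup` Thm. 1.2 (i) "unit-profinite": `thm12_i_unitProfinite` (`PadicUnitGroupProfinite.lean`).
PROVED here by substitution (no new statement, no definition): `rmk121_bindFrobenius_holds` — Remark 1.2.1
for every `p`-adic Frobenioid datum with `Φ`, `B` monoids on `D`, at ANY vocabulary record `V` through its
Frobenius-bound form `V.bindFrobenius`; `rmk121_bindFrobenius_holds_of_isOfFSMType` — premise-free over a
base of FSM-type; `admitsFrobeniusFunctors_of_isAbsolutelyPrimitive` — the three conclusions unpacked.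
Nothing here bears on [IUTchIII] Cor. 3.12; no side taken.
-/

noncomputable section

namespace Literature.AlgebraicGeometry.Frobenioids

open CategoryTheory Opposite

namespace PadicFrd

namespace Datum

universe v u

variable {D : Type u} [Category.{v} D] {p : ℕ} [Fact p.Prime] (d : Datum D p)

/-- **[FrdII] Remark 1.2.1, UNCONDITIONAL** (Kyushu p. 408: "if `Φ` is absolutely primitive, then by Theorem
1.2(i) and (v), it follows that `C` admits unit-linear Frobenius functors as in [Mzk5, Proposition 2.5(iii)]
…, and unit-wise Frobenius functors as in [Mzk5, Corollary 2.6]. If, moreover, `Λ = ℤ`, then `C` admits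
unit-wise Frobenius functors as in [Mzk5, Proposition 2.9(ii)]"): abc-iut-L1-t4's `Rmk121 d V` HOLDS at the
Frobenius-bound record `V.bindFrobenius` for every datum with `Φ`, `B` monoids on `D` — abc-iut-L1-t4 gen 2's
conditional `rmk121_bindFrobenius` with all seven hypotheses supplied by the tree's theorems ([FrdI] Prop.
2.5 (iii) / Cor. 2.6 / Prop. 2.9 (ii) proved; isotropic, pre-model, unit-profinite = Thm. 1.2 (i) proved).
[cite: MochizukiFrdII2008, Rmk 1.2.1 p.10] -/
theorem rmk121_bindFrobenius_holds (V : Thm12Vocab d) (h : d.IsMonoidData) : Rmk121 d V.bindFrobenius :=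
  d.rmk121_bindFrobenius V (d.isFrobenioid_of_isMonoidData h)
    (fun n => PreFrobenioid.unitLinearFrobeniusExists n)
    (fun n => PreFrobenioid.unitWiseFrobeniusExists n)
    (fun ζ => PreFrobenioid.unitWiseFrobeniusZetaExists ζ)
    d.thm12_isOfIsotropicType d.thm12_isOfPreModelType' d.thm12_i_unitProfinite

/-- **[FrdII] Remark 1.2.1, PREMISE-FREE over a base of FSM-type** (where `Φ`, `B` are automatically
monoids on `D`, `isMonoidData_of_isOfFSMType`; e.g. `D = D₀`, or `B^temp(Π, Π°)⁰` of Ex. 1.3 (i)).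
[cite: MochizukiFrdII2008, Rmk 1.2.1 p.10] -/
theorem rmk121_bindFrobenius_holds_of_isOfFSMType (V : Thm12Vocab d) (hD : IsOfFSMType D) :
    Rmk121 d V.bindFrobenius :=
  d.rmk121_bindFrobenius_holds V (d.isMonoidData_of_isOfFSMType hD)

/-- **[FrdII] Remark 1.2.1, conclusions unpacked**: for `Φ` absolutely primitive (and `Φ`, `B` monoids on
`D`) the `p`-adic Frobenioid admits unit-linear Frobenius functors ([FrdI] Prop. 2.5 (iii), `Λ = ℤ`),
unit-wise Frobenius functors ([FrdI] Cor. 2.6) and unit-wise Frobenius functors II ([FrdI] Prop. 2.9 (ii))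
— the three BOUND slots of `Thm12Vocab.bindFrobenius` (seat abc-iut-L1-t4 gen 2), read at any `V`.
[cite: MochizukiFrdII2008, Rmk 1.2.1 p.10] -/
theorem admitsFrobeniusFunctors_of_isAbsolutelyPrimitive (V : Thm12Vocab d) (h : d.IsMonoidData)
    (hap : d.IsAbsolutelyPrimitive) :
    (V.bindFrobenius).AdmitsUnitLinearFrobeniusFunctors ∧ (V.bindFrobenius).AdmitsUnitwiseFrobeniusFunctorsI ∧
      (V.bindFrobenius).AdmitsUnitwiseFrobeniusFunctorsII :=
  d.rmk121_bindFrobenius_holds V h hap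

end Datum

end PadicFrd

end Literature.AlgebraicGeometry.Frobenioids

end
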